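import Summits.SmoothPoincare4.SmoothPoincare4.Theorems.ConvexBisectionAcyclicBisectionExistsSeamTwistSignGlobal
import Summits.SmoothPoincare4.SmoothPoincare4.Theorems.ConvexBisectionAcyclicBisectionExistsBaseReflectionTwisting
import HarnessLib

/-!
# Seam transport, ST4 `node_ST4_twistSign`: the global twisting sign of a page-preserving seam map
(wave 5, crux stmt-SmoothPoincare4-10508, line `modp-braid-orbits`, stub `stub_T3_dualPresentation` (T3)
▸ node T3c-2 `node_seam_transport` ▸ sub-node ST4; registered sub-goal `helper_seam_twistSign` = the
node text `node_ST4_twistSign` of `work/design/T3c2_SeamTransport_Design.lean` with the page clause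
inlined, i.e. EXACTLY the hypothesis `H4` of the landed contract `node_seam_transport_of_twistSign`
(`…SeamTransportAssembly.lean`))

**Theorem** (`helper_seam_twistSign`; knot-level form given the sign: `seam_twistSign_of_sign`).  For a Lefschetz link `h` on `Base g` and the
data `(D, bX, Ψ)` of a fibred model with the page clause (`w (Ψ y) = c · w a`, `c > 0`, whenever
`bX.incl y = D.jA a`) there is `s₀ = ±1` such that for every framed page knot `(K ⊂ page g c, ν)` off the
cores with lifts `z`, `u` through `bX.incl`, and every fibred ambient isotopy `R` of `Base g` (preserving
`rho` and the direction of `w`) whose time-`1` map flattens the pushed knot into `page g c`, the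
transported framed knot `(R_1 ∘ incl ∘ Ψ ∘ z, dR_1 d(incl ∘ Ψ) u)` has page twisting
`s₀ · pageTwisting g K ν`.

Proof.  `s₀` is the global sign of `helper_seam_twistSign_global` (`…SeamTwistSignGlobal.lean`).  The
lifts are forced (`…SeamTwistSignLift.lean`): the transported knot is `Γ ∘ K̂` with
`Γ = R_1 ∘ seamB D bX Ψ` and `K̂` the knot lifted to the boundary 3-manifold, and the transported framing
is `dΓ (tail ν)`.  POINTWISE (§1), with `Λ = bdDeriv g Γ (K̂ θ)` (`…SeamTwistSignBoundaryDeriv.lean`): the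
transported ambient velocity and framing vector are `Λ T`, `Λ V`; `Γ` is fibred and flat-to-flat at
`K̂ θ`, so (`helper_bdDeriv_fibred`) `⟪Λ V, ñ⟫ = κ ⟪V, n⟫` with `κ > 0` and, where `⟪V, n⟫ = 0` (the
framing vector is a page tangent), `⟪Λ V, iΛT⟫ = b ⟪V, iT⟫` (`inner_cplxJ_map_of_mem_line`) with
`b · ‖T‖²` a positive multiple of `pageDet g Λ` (`inner_cplxJ_map_eq_mul_pageDet`), whose sign is `s₀`.
So the two twisting loops satisfy the hypotheses of the winding step with pointwise coefficients
(`wind_eq_of_pointwise_frame`, `…SeamTwistSignFrame.lean`), §2.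

Everything is proved; no named facts, no `sorry`.  References: J. B. Etnyre, T. Fuller, IMRN 2006,
Thm. 1 (proof, p. 8) [EtnyreFuller2006]; R. İ. Baykur, AGT 6 (2006), Thm. 5.1 (proof, p. 13)
[Baykur2006].
-/

noncomputable section

set_option linter.dupNamespace false

open scoped Manifold ContDiff Topology ComplexConjugate

namespace Summit.SmoothPoincare4.SmoothPoincare4.Theorems.AcyclicBisectionExists.ModpBraidOrbits

open Set Function Filter Complex Bundle
open Literature.Topology.FourManifolds Literature.Topology.FourManifolds.HandleAttachingMap
  Literature.Topology.FourManifolds.BoundaryManifold Literature.Topology.FourManifolds.LefschetzBase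
  Literature.Geometry.Symplectic Literature.Topology.PlaneTopology

variable {g : ℕ}

/-! ## §1 The lifted knot and the transported velocity and framing vectors -/

section Knot

variable {ι : Type} [Finite ι] {h : ι → HandleAttachingMap 3 2 (Base g)}
  {X : Type} [TopologicalSpace X] [ChartedSpace (EuclideanHalfSpace 4) X] [IsManifold (𝓡∂ 4) ∞ X]
  (D : MultiAttachmentData h (𝓡∂ 4) X) (bX : BoundaryData (𝓡∂ 4) X (𝓡 3)) [Nonempty bX.carrier]
  (Ψ : bX.carrier ≃ₘ⟮𝓡 3, 𝓡 3⟯ (bBase g).carrier)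

/-- The velocity of a knot of `∂ Base g` is the boundary image `(0, ẏ)` of the velocity `ẏ` of its lift
to the boundary 3-manifold. [folklore] -/
theorem knotVelocity_eq_consZeroL {K : Metric.sphere (0 : EuclideanSpace ℝ (Fin 2)) 1 → Base g}
    (hKb : IsBoundaryKnot K) (t : ℝ) :
    knotVelocity K t = consZeroL 3 (mfderiv 𝓘(ℝ, ℝ) (𝓡 3) (knotLift hKb ∘ circlePt) t (1 : ℝ)) := by
  have hŷ : MDifferentiableAt 𝓘(ℝ, ℝ) (𝓡 3) (knotLift hKb ∘ circlePt) t :=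
    ((contMDiff_knotLift hKb).comp contMDiff_circlePt).mdifferentiableAt (by simp)
  have h1 : HasMFDerivAt 𝓘(ℝ, ℝ) (𝓡∂ 4) ((bBase g).incl ∘ (knotLift hKb ∘ circlePt)) t
      ((consZeroL 3).comp (mfderiv 𝓘(ℝ, ℝ) (𝓡 3) (knotLift hKb ∘ circlePt) t)) :=
    (hasMFDerivAt_incl_boundaryData (n := 3) _).comp t hŷ.hasMFDerivAt
  have he : (bBase g).incl ∘ (knotLift hKb ∘ circlePt) = K ∘ circlePt := rfl
  rw [he] at h1
  unfold knotVelocity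
  rw [h1.mfderiv]
  rfl

/-- **The transported ambient velocity**: for `Γ : ∂ Base g → Base g` differentiable at the lifted point,
`(ambCurve (Γ ∘ K̂))' = bdDeriv g Γ (K̂ θ) (ambCurve K)'`. [folklore] -/
theorem deriv_ambCurve_comp_knotLift {K : Metric.sphere (0 : EuclideanSpace ℝ (Fin 2)) 1 → Base g}
    (hKb : IsBoundaryKnot K) {Γ : (bBase g).carrier → Base g} (t : ℝ)
    (hΓ : MDifferentiableAt (𝓡 3) (𝓡∂ 4) Γ (knotLift hKb (circlePt t))) :
    deriv (ambCurve g (Γ ∘ knotLift hKb)) t = bdDeriv g Γ (knotLift hKb (circlePt t)) (deriv (ambCurve g K) t) := by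
  have hKd : MDifferentiableAt (𝓡 1) (𝓡∂ 4) K (circlePt t) :=
    hKb.isSmoothEmbedding.contMDiff.mdifferentiableAt (by simp)
  have hŷ : MDifferentiableAt 𝓘(ℝ, ℝ) (𝓡 3) (knotLift hKb ∘ circlePt) t :=
    ((contMDiff_knotLift hKb).comp contMDiff_circlePt).mdifferentiableAt (by simp)
  -- the old velocity
  rw [deriv_ambCurve hKd, knotVelocity_eq_consZeroL hKb t]
  rw [show K (circlePt t) = (knotLift hKb (circlePt t)).1 from rfl, bdDeriv_ambient hΓ]
  -- the new velocity by the chain rule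
  have h1 : HasMFDerivAt 𝓘(ℝ, ℝ) (𝓡 4)
      ((fun y' => ((Γ y').1 : EuclideanSpace ℝ (Fin 4))) ∘ (knotLift hKb ∘ circlePt)) t
      (((ambientCLM g (Γ (knotLift hKb (circlePt t)))).comp (mfderiv (𝓡 3) (𝓡∂ 4) Γ _)).comp
        (mfderiv 𝓘(ℝ, ℝ) (𝓡 3) (knotLift hKb ∘ circlePt) t)) :=
    (hasMFDerivAt_val_comp hΓ).comp t hŷ.hasMFDerivAt
  have he : (fun y' => ((Γ y').1 : EuclideanSpace ℝ (Fin 4))) ∘ (knotLift hKb ∘ circlePt) =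
      ambCurve g (Γ ∘ knotLift hKb) := rfl
  rw [he] at h1
  rw [← fderiv_apply_one_eq_deriv, ← mfderiv_eq_fderiv, h1.mfderiv]
  rfl

/-- **The transported ambient framing vector**: `ambient (dΓ (tail ν)) = bdDeriv g Γ y (ambient ν)` for a
vector `ν` tangent to the boundary (`ν₀ = 0`). [folklore] -/
theorem ambient_mfderiv_tail {Γ : (bBase g).carrier → Base g} {y : (bBase g).carrier}
    (hΓ : MDifferentiableAt (𝓡 3) (𝓡∂ 4) Γ y) {ν : EuclideanSpace ℝ (Fin 4)} (hν : ν 0 = 0) :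
    ambient g (Γ y) (mfderiv (𝓡 3) (𝓡∂ 4) Γ y (tail 3 ν)) = bdDeriv g Γ y (ambient g y.1 ν) := by
  conv_rhs => rw [← consCLE_tail_of_eq_zero 3 hν, ← consZeroL_apply]
  rw [bdDeriv_ambient hΓ]

/-- **The pointwise frame relations of a transported framed page knot.**  Let `(K ⊂ page g c, ν)` be a
framed page knot with lift `K̂` to the boundary 3-manifold, `Γ : ∂ Base g → Base g` differentiable at
`K̂ θ` (`θ = e^{2πit}`), with boundary values, direction preserving near `K̂ θ`, and `Γ (K̂ θ)` flat; let
`Λ = bdDeriv g Γ (K̂ θ)` and suppose `0 < s₀ · pageDet g Λ`.  Then the twisting loops `ℓ` of `(K, ν)` and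
`ℓ'` of `(Γ ∘ K̂, dΓ (tail ν))` satisfy at `t`: `ℓ'₂ = κ ℓ₂` (`κ > 0`) and `ℓ₂ = 0 ⇒ ℓ'₁ = b ℓ₁` with
`s₀ b > 0`. [cite: EtnyreFuller2006, Thm. 1 (proof, p. 8)] -/
theorem twistingLoop_frame_pointwise {c : ℂ} (hc : ‖c‖ = 1)
    {K : Metric.sphere (0 : EuclideanSpace ℝ (Fin 2)) 1 → Base g}
    {ν : Metric.sphere (0 : EuclideanSpace ℝ (Fin 2)) 1 → EuclideanSpace ℝ (Fin 4)}
    (hKp : ∀ θ, K θ ∈ page g c) (hKb : IsBoundaryKnot K) (hKν : IsKnotFraming K ν)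
    {Γ : (bBase g).carrier → Base g} {s₀ : ℤ} (t : ℝ)
    (hΓd : MDifferentiableAt (𝓡 3) (𝓡∂ 4) Γ (knotLift hKb (circlePt t)))
    (hbd : ∀ y', rho g (Γ y').1 = 1 / 4)
    (hdir : ∀ᶠ y' in 𝓝 (knotLift hKb (circlePt t)), ∃ r : ℝ, 0 < r ∧ w g (Γ y').1 = (r : ℂ) * w g y'.1.1)
    (hΓflat : ‖cx (Γ (knotLift hKb (circlePt t))).1‖ ^ 2 < 4)
    (hpos : 0 < (s₀ : ℝ) * pageDet g (bdDeriv g Γ (knotLift hKb (circlePt t))) (K (circlePt t)).1) :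
    (∃ κ : ℝ, 0 < κ ∧ (pageTwistingLoop g (Γ ∘ knotLift hKb)
        (fun θ => mfderiv (𝓡 3) (𝓡∂ 4) Γ (knotLift hKb θ) (tail 3 (ν θ))) t).im =
        κ * (pageTwistingLoop g K ν t).im) ∧
    ((pageTwistingLoop g K ν t).im = 0 → ∃ b : ℝ, 0 < (s₀ : ℝ) * b ∧
      (pageTwistingLoop g (Γ ∘ knotLift hKb)
        (fun θ => mfderiv (𝓡 3) (𝓡∂ 4) Γ (knotLift hKb θ) (tail 3 (ν θ))) t).re =
        b * (pageTwistingLoop g K ν t).re) := by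
  set θt := circlePt t with hθt
  set y : (bBase g).carrier := knotLift hKb θt with hy_def
  set Λ := bdDeriv g Γ y with hΛ
  set T := deriv (ambCurve g K) t with hT
  set V := ambient g (K θt) (ν θt) with hV
  have hν0 : ν θt 0 = 0 := (mem_boundaryTangentSpace_iff _).1 (hKν.mem_boundaryTangentSpace θt)
  have hKd : MDifferentiableAt (𝓡 1) (𝓡∂ 4) K θt :=
    hKb.isSmoothEmbedding.contMDiff.mdifferentiableAt (by simp)
  -- the transported velocity and framing vector are `Λ T`, `Λ V`
  have eT : deriv (ambCurve g (Γ ∘ knotLift hKb)) t = Λ T := deriv_ambCurve_comp_knotLift hKb t hΓd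
  have eV : ambient g ((Γ ∘ knotLift hKb) θt) (mfderiv (𝓡 3) (𝓡∂ 4) Γ (knotLift hKb θt) (tail 3 (ν θt))) =
      Λ V := ambient_mfderiv_tail hΓd hν0
  have hℓ't : pageTwistingLoop g (Γ ∘ knotLift hKb)
      (fun θ => mfderiv (𝓡 3) (𝓡∂ 4) Γ (knotLift hKb θ) (tail 3 (ν θ))) t =
      ⟨inner ℝ (Λ V) (cplxJ (Λ T)), inner ℝ (Λ V) (horizNormal g (Γ y).1)⟩ := by
    unfold pageTwistingLoop
    rw [eT, eV]
    rfl
  have hℓt : pageTwistingLoop g K ν t = ⟨inner ℝ V (cplxJ T), inner ℝ V (horizNormal g y.1.1)⟩ := rfl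
  -- flatness and the fibred frame data of `Γ` at `y`
  obtain ⟨hflat, hw⟩ := flat_of_mem_page hc (hKp θt)
  obtain ⟨-, ⟨κ, hκ, hnorm⟩, hL⟩ := helper_bdDeriv_fibred g Γ y hΓd hbd hdir hflat hΓflat hw
  -- tangency of `V` and `T`
  have hbdry : rho g (K θt).1 = 1 / 4 := rho_eq_of_mem_page g hc (hKp θt)
  have hVρ : fderiv ℝ (rho g) y.1.1 V = 0 := by
    show fderiv ℝ (rho g) (K θt).1 (ambient g (K θt) (ν θt)) = 0
    rw [fderiv_rho_ambient _ hbdry, hν0, neg_zero]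
  have hTd := hasDerivAt_ambCurve (g := g) hKd
  have hTL : dPhiX g y.1.1 * cx T + dPhiY y.1.1 * cy T = 0 :=
    dPhi_velocity_eq_zero_of_page hKp hTd.differentiableAt.hasDerivAt
  have hT0 : T ≠ 0 := by
    rw [hT, hTd.deriv]
    intro h0
    exact knotVelocity_ne_zero hKb.isSmoothEmbedding t (injective_ambient _ (h0.trans (map_zero _).symm))
  refine ⟨⟨κ, hκ, ?_⟩, fun him => ?_⟩
  · rw [hℓ't, hℓt]; exact hnorm V hVρ
  · -- the framing vector is a page tangent: `dΦ V = 0`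
    have him' : inner ℝ V (horizNormal g y.1.1) = 0 := by rw [hℓt] at him; exact him
    have hVL : dPhiX g y.1.1 * cx V + dPhiY y.1.1 * cy V = 0 := by
      have hflat' : ‖cx y.1.1‖ ^ 2 < 4 := hflat
      have hre : (conj (w g y.1.1) * (dPhiX g y.1.1 * cx V + dPhiY y.1.1 * cy V)).re = 0 := by
        rw [fderiv_rho_apply_of_flat hflat'] at hVρ; linarith
      have him2 : (conj (w g y.1.1) * (dPhiX g y.1.1 * cx V + dPhiY y.1.1 * cy V)).im = 0 := by
        rw [inner_horizNormal, div_eq_zero_iff] at him'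
        exact him'.resolve_right (normSq_dPhi_ne_zero (coe_ne_zero y.1))
      have hprod : conj (w g y.1.1) * (dPhiX g y.1.1 * cx V + dPhiY y.1.1 * cy V) = 0 :=
        Complex.ext (by rw [hre, Complex.zero_re]) (by rw [him2, Complex.zero_im])
      exact (mul_eq_zero.1 hprod).resolve_left ((map_ne_zero _).2 hw)
    have hrel := inner_cplxJ_map_of_mem_line Λ.toLinearMap (coe_ne_zero y.1) hT0 hTL hVL
    obtain ⟨c₀, hc₀, hpd⟩ := inner_cplxJ_map_eq_mul_pageDet Λ (coe_ne_zero y.1) hT0 hTL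
    refine ⟨inner ℝ (Λ (cplxJ T)) (cplxJ (Λ T)) / ‖T‖ ^ 2, ?_, ?_⟩
    · have hT2 : (0 : ℝ) < ‖T‖ ^ 2 := by positivity
      rw [hpd]
      have e : (s₀ : ℝ) * (c₀ * pageDet g Λ y.1.1 / ‖T‖ ^ 2) =
          ((s₀ : ℝ) * pageDet g Λ y.1.1) * (c₀ / ‖T‖ ^ 2) := by ring
      rw [e]
      exact mul_pos hpos (div_pos hc₀ hT2)
    · rw [hℓ't, hℓt]
      exact hrel

/-- **The page twisting of a transported framed page knot from the pointwise frame relations**: if the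
twisting loop of `(Γ ∘ K̂, dΓ (tail ν))` is continuous and the conclusions of
`twistingLoop_frame_pointwise` hold at every parameter, then its page twisting is `s₀ · pageTwisting g K ν`
(`wind_eq_of_pointwise_frame`). [cite: EtnyreFuller2006, Thm. 1 (proof, p. 8)] -/
theorem pageTwisting_comp_of_frame {c : ℂ} (hc : ‖c‖ = 1)
    {K : Metric.sphere (0 : EuclideanSpace ℝ (Fin 2)) 1 → Base g}
    {ν : Metric.sphere (0 : EuclideanSpace ℝ (Fin 2)) 1 → EuclideanSpace ℝ (Fin 4)}
    (hKp : ∀ θ, K θ ∈ page g c) (hKb : IsBoundaryKnot K) (hKν : IsKnotFraming K ν)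
    {Γ : (bBase g).carrier → Base g} {s₀ : ℤ} (hs₀ : s₀ = 1 ∨ s₀ = -1)
    (hℓ'c : Continuous (pageTwistingLoop g (Γ ∘ knotLift hKb)
      (fun θ => mfderiv (𝓡 3) (𝓡∂ 4) Γ (knotLift hKb θ) (tail 3 (ν θ)))))
    (hP : ∀ t : ℝ, (∃ κ : ℝ, 0 < κ ∧ (pageTwistingLoop g (Γ ∘ knotLift hKb)
        (fun θ => mfderiv (𝓡 3) (𝓡∂ 4) Γ (knotLift hKb θ) (tail 3 (ν θ))) t).im =
        κ * (pageTwistingLoop g K ν t).im) ∧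
      ((pageTwistingLoop g K ν t).im = 0 → ∃ b : ℝ, 0 < (s₀ : ℝ) * b ∧
        (pageTwistingLoop g (Γ ∘ knotLift hKb)
          (fun θ => mfderiv (𝓡 3) (𝓡∂ 4) Γ (knotLift hKb θ) (tail 3 (ν θ))) t).re =
          b * (pageTwistingLoop g K ν t).re)) :
    pageTwisting g (Γ ∘ knotLift hKb) (fun θ => mfderiv (𝓡 3) (𝓡∂ 4) Γ (knotLift hKb θ) (tail 3 (ν θ))) =
      s₀ * pageTwisting g K ν := by
  have hK1 : ContMDiff (𝓡 1) (𝓡∂ 4) 1 K := hKb.isSmoothEmbedding.contMDiff.of_le (by simp)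
  have hℓc : Continuous (pageTwistingLoop g K ν) := continuous_pageTwistingLoop hK1 hKν.continuous
  have hℓ0 : ∀ t, pageTwistingLoop g K ν t ≠ 0 := fun t =>
    pageTwistingLoop_ne_zero_of_isKnotFraming hc hKb.isSmoothEmbedding hKp hKν t
  exact wind_eq_of_pointwise_frame hℓc hℓ'c pageTwistingLoop_zero_eq_one pageTwistingLoop_zero_eq_one hℓ0
    hs₀ (fun t _ => (hP t).1) (fun t _ => (hP t).2)

end Knot

/-! ## §2 The twisting sign of a transported framed page knot -/

section Transport

variable {l : List ((Fin g ⊕ Fin g → ℤ) × Bool)} {h : Fin l.length → HandleAttachingMap 3 2 (Base g)}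
  {X : Type} [TopologicalSpace X] [T2Space X] [ChartedSpace (EuclideanHalfSpace 4) X] [IsManifold (𝓡∂ 4) ∞ X]
  (D : MultiAttachmentData h (𝓡∂ 4) X) (bX : BoundaryData (𝓡∂ 4) X (𝓡 3)) [Nonempty bX.carrier]
  (Ψ : bX.carrier ≃ₘ⟮𝓡 3, 𝓡 3⟯ (bBase g).carrier)
  (hpage : ∀ (y : bX.carrier) (a : ↥(coresComplement h)), bX.incl y = D.jA a →
    ∃ c : ℝ, 0 < c ∧ w g ((bBase g).incl (Ψ y)).1 = (c : ℂ) * w g (a : Base g).1)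

include hpage in
/-- **The page twisting of a transported framed page knot, given the global sign.**  If `s₀ = ±1` has the
property of `helper_seam_twistSign_global`, then for every framed page knot off the cores with lifts
`z`, `u` and every fibred flattening `R`, the transported framed knot has page twisting
`s₀ · pageTwisting g K ν`. [cite: EtnyreFuller2006, Thm. 1 (proof, p. 8)] -/
theorem seam_twistSign_of_sign {s₀ : ℤ} (hs₀ : s₀ = 1 ∨ s₀ = -1)
    (hsign : ∀ (y : (bBase g).carrier) (hy : (y.1 : Base g) ∈ coresComplement h) (c : ℂ) (_ : ‖c‖ = 1)
      (_ : y.1 ∈ page g c) (R : AmbientIsotopy (𝓡∂ 4) (Base g))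
      (_ : ∀ (t : ℝ) (x : Base g), rho g (R.toFun t x).1 = rho g x.1)
      (_ : ∀ (t : ℝ) (x : Base g), ∃ r : ℝ, 0 < r ∧ w g (R.toFun t x).1 = (r : ℂ) * w g x.1)
      (_ : R.toFun 1 (seamB D bX Ψ y) ∈ page g c),
      0 < (s₀ : ℝ) * pageDet g (bdDeriv g (R.toFun 1 ∘ seamB D bX Ψ) y) y.1.1)
    (c : ℂ) (hc : ‖c‖ = 1) (K : Metric.sphere (0 : EuclideanSpace ℝ (Fin 2)) 1 → Base g)
    (ν : Metric.sphere (0 : EuclideanSpace ℝ (Fin 2)) 1 → EuclideanSpace ℝ (Fin 4))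
    (hK : ∀ θ, K θ ∈ coresComplement h) (hKp : ∀ θ, K θ ∈ page g c)
    (hKb : IsBoundaryKnot K) (hKν : IsKnotFraming K ν)
    (z : Metric.sphere (0 : EuclideanSpace ℝ (Fin 2)) 1 → bX.carrier)
    (hz : ∀ θ, bX.incl (z θ) = D.jA ⟨K θ, hK θ⟩)
    (u : Metric.sphere (0 : EuclideanSpace ℝ (Fin 2)) 1 → EuclideanSpace ℝ (Fin 3))
    (hu : ∀ θ, mfderiv (𝓡 3) (𝓡∂ 4) bX.incl (z θ) (u θ) =
      mfderiv (𝓡∂ 4) (𝓡∂ 4) (fun a : ↥(coresComplement h) => D.jA a) ⟨K θ, hK θ⟩ (ν θ))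
    (R : AmbientIsotopy (𝓡∂ 4) (Base g))
    (hRρ : ∀ (t : ℝ) (x : Base g), rho g (R.toFun t x).1 = rho g x.1)
    (hRdir : ∀ (t : ℝ) (x : Base g), ∃ r : ℝ, 0 < r ∧ w g (R.toFun t x).1 = (r : ℂ) * w g x.1)
    (hR1 : ∀ θ, R.toFun 1 ((bBase g).incl (Ψ (z θ))) ∈ page g c) :
    pageTwisting g (R.toFun 1 ∘ fun θ => ((bBase g).incl (Ψ (z θ)) : Base g))
        (fun θ => mfderiv (𝓡∂ 4) (𝓡∂ 4) (R.toFun 1) ((bBase g).incl (Ψ (z θ)))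
          (mfderiv (𝓡 3) (𝓡∂ 4) (fun y => ((bBase g).incl (Ψ y) : Base g)) (z θ) (u θ))) =
      s₀ * pageTwisting g K ν := by
  -- ST1: the pushed framed knot
  obtain ⟨hkb, hkμ, -, -⟩ := seam_extendedPage D bX Ψ hpage c K ν hK hKp hKb hKν z hz u hu
  -- identifications: pushed point `= seamB (K̂ θ)`, pushed vector `= d(seamB) (tail ν)`
  have hy : ∀ θ, ((knotLift hKb θ).1 : Base g) ∈ coresComplement h := hK
  have hν0 : ∀ θ, ν θ 0 = 0 := fun θ => (mem_boundaryTangentSpace_iff _).1 (hKν.mem_boundaryTangentSpace θ)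
  have hpt : ∀ θ, ((bBase g).incl (Ψ (z θ)) : Base g) = seamB D bX Ψ (knotLift hKb θ) := fun θ =>
    incl_apply_eq_seamB D bX Ψ (hy θ) (hz θ)
  have hvec : ∀ θ, mfderiv (𝓡 3) (𝓡∂ 4) (fun y => ((bBase g).incl (Ψ y) : Base g)) (z θ) (u θ) =
      mfderiv (𝓡 3) (𝓡∂ 4) (seamB D bX Ψ) (knotLift hKb θ) (tail 3 (ν θ)) := fun θ =>
    mfderiv_push_eq_mfderiv_seamB D bX Ψ (hy θ) (hz θ) (hν0 θ) (hu θ)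
  have hsBd : ∀ θ, MDifferentiableAt (𝓡 3) (𝓡∂ 4) (seamB D bX Ψ) (knotLift hKb θ) := fun θ =>
    (contMDiffAt_seamB D bX Ψ (hy θ)).mdifferentiableAt (by simp)
  have hR1d : ∀ x : Base g, MDifferentiableAt (𝓡∂ 4) (𝓡∂ 4) (R.toFun 1) x := fun x =>
    (R.contMDiff_toFun 1).mdifferentiableAt (by simp)
  -- the transported knot and framing in terms of `Γ = R_1 ∘ seamB`
  have eK : (R.toFun 1 ∘ fun θ => ((bBase g).incl (Ψ (z θ)) : Base g)) =
      (R.toFun 1 ∘ seamB D bX Ψ) ∘ knotLift hKb := by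
    funext θ
    show R.toFun 1 ((bBase g).incl (Ψ (z θ)) : Base g) = R.toFun 1 (seamB D bX Ψ (knotLift hKb θ))
    rw [hpt]
  have eν : (fun θ => mfderiv (𝓡∂ 4) (𝓡∂ 4) (R.toFun 1) ((bBase g).incl (Ψ (z θ)))
      (mfderiv (𝓡 3) (𝓡∂ 4) (fun y => ((bBase g).incl (Ψ y) : Base g)) (z θ) (u θ))) =
      fun θ => mfderiv (𝓡 3) (𝓡∂ 4) (R.toFun 1 ∘ seamB D bX Ψ) (knotLift hKb θ) (tail 3 (ν θ)) := by
    funext θ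
    rw [hvec, hpt, mfderiv_comp _ (hR1d _) (hsBd θ)]
    rfl
  -- continuity of the transported twisting loop (in the original form, then transferred)
  have hk1 : ContMDiff (𝓡 1) (𝓡∂ 4) 1 (fun θ => ((bBase g).incl (Ψ (z θ)) : Base g)) :=
    hkb.isSmoothEmbedding.contMDiff.of_le (by simp)
  have hℓ'c : Continuous (pageTwistingLoop g (R.toFun 1 ∘ fun θ => ((bBase g).incl (Ψ (z θ)) : Base g))
      (fun θ => mfderiv (𝓡∂ 4) (𝓡∂ 4) (R.toFun 1) ((bBase g).incl (Ψ (z θ)))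
        (mfderiv (𝓡 3) (𝓡∂ 4) (fun y => ((bBase g).incl (Ψ y) : Base g)) (z θ) (u θ)))) := by
    refine continuous_pageTwistingLoop ((R.contMDiff_toFun 1).of_le (by simp) |>.comp hk1) ?_
    exact (continuous_mfderiv_ambientIsotopy_bundle R hkμ.continuous).comp
      (continuous_const.prodMk continuous_id)
  rw [eK, eν] at hℓ'c ⊢
  -- the pointwise frame relations
  refine pageTwisting_comp_of_frame hc hKp hKb hKν hs₀ hℓ'c fun t => ?_
  refine twistingLoop_frame_pointwise hc hKp hKb hKν t ((hR1d _).comp _ (hsBd _)) (fun y' => ?_)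
    (eventually_w_comp_seamB D bX Ψ (hRdir 1) hpage (hy _)) ?_ ?_
  · show rho g (R.toFun 1 (seamB D bX Ψ y')).1 = 1 / 4
    rw [hRρ, rho_seamB]
  · show ‖cx (R.toFun 1 (seamB D bX Ψ (knotLift hKb (circlePt t)))).1‖ ^ 2 < 4
    rw [← hpt]; exact (hR1 _).1
  · exact hsign _ (hy _) c hc (hKp _) R hRρ hRdir (by rw [← hpt]; exact hR1 _)

end Transport

/-! ## §3 The node: `node_ST4_twistSign` -/

/-- **Sub-goal `helper_seam_twistSign` of stub `stub_T3_dualPresentation` = SUB-NODE ST4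
`node_ST4_twistSign` of node T3c-2 `node_seam_transport`** (wave 5, lead c5; the text of
`work/design/T3c2_SeamTransport_Design.lean` with the page clause inlined = the hypothesis `H4` of the
landed contract `node_seam_transport_of_twistSign`): **the global twisting sign.**  For a Lefschetz link
`h` and the data `(D, bX, Ψ)` of a fibred model with the page clause there is `s₀ = ±1` such that for
every framed page knot `(K ⊂ page g c, ν)` off the cores, lifts `z`, `u` through `bX.incl`, and every
fibred ambient isotopy `R` of `Base g` (preserving `rho` and the direction of `w` at all times) whose
time-`1` map flattens the pushed knot into `page g c`, the transported framed knot
`(R_1 ∘ incl ∘ Ψ ∘ z, dR_1 d(incl ∘ Ψ) u)` has page twisting `s₀ · pageTwisting g K ν`.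
[cite: EtnyreFuller2006, Thm. 1 (proof, p. 8)] -/
theorem helper_seam_twistSign : ∀ (g : ℕ) (l : List ((Fin g ⊕ Fin g → ℤ) × Bool)) (h : Fin l.length → Literature.Topology.FourManifolds.HandleAttachingMap 3 2 (Literature.Topology.FourManifolds.LefschetzBase.Base g)), Literature.Topology.FourManifolds.LefschetzBase.IsLefschetzLink g l h → ∀ {X : Type} [TopologicalSpace X] [T2Space X] [SecondCountableTopology X] [CompactSpace X] [ChartedSpace (EuclideanHalfSpace 4) X] [IsManifold (𝓡∂ 4) ∞ X] (D : Literature.Topology.FourManifolds.HandleAttachingMap.MultiAttachmentData h (𝓡∂ 4) X) (bX : Literature.Topology.FourManifolds.BoundaryData (𝓡∂ 4) X (𝓡 3)) (Ψ : bX.carrier ≃ₘ⟮𝓡 3, 𝓡 3⟯ (Literature.Topology.FourManifolds.LefschetzBase.bBase g).carrier), (∀ (y : bX.carrier) (a : ↥(Literature.Topology.FourManifolds.HandleAttachingMap.coresComplement h)), bX.incl y = D.jA a → ∃ c : ℝ, 0 < c ∧ Literature.Topology.FourManifolds.LefschetzBase.w g ((Literature.Topology.FourManifolds.LefschetzBase.bBase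 g).incl (Ψ y)).1 = (c : ℂ) * Literature.Topology.FourManifolds.LefschetzBase.w g (a : Literature.Topology.FourManifolds.LefschetzBase.Base g).1) → ∃ s₀ : ℤ, (s₀ = 1 ∨ s₀ = -1) ∧ ∀ (c : ℂ) (_ : ‖c‖ = 1) (K : Metric.sphere (0 : EuclideanSpace ℝ (Fin 2)) 1 → Literature.Topology.FourManifolds.LefschetzBase.Base g) (ν : Metric.sphere (0 : EuclideanSpace ℝ (Fin 2)) 1 → EuclideanSpace ℝ (Fin 4)) (hK : ∀ θ, K θ ∈ Literature.Topology.FourManifolds.HandleAttachingMap.coresComplement h) (_ : ∀ θ, K θ ∈ Literature.Topology.FourManifolds.LefschetzBase.page g c) (_ : Literature.Geometry.Symplectic.IsBoundaryKnot K) (_ : Literature.Geometry.Symplectic.IsKnotFraming K ν) (z : Metric.sphere (0 : EuclideanSpace ℝ (Fin 2)) 1 → bX.carrier) (_ : ∀ θ, bX.incl (z θ) = D.jA ⟨K θ, hK θ⟩) (u : Metric.sphere (0 : EuclideanSpace ℝ (Fin 2)) 1 → EuclideanSpace ℝ (Fin 3)) (_ : ∀ θ, mfderiv (𝓡 3) (𝓡∂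 4) bX.incl (z θ) (u θ) = mfderiv (𝓡∂ 4) (𝓡∂ 4) (fun a : ↥(Literature.Topology.FourManifolds.HandleAttachingMap.coresComplement h) => D.jA a) ⟨K θ, hK θ⟩ (ν θ)) (R : Literature.Topology.FourManifolds.AmbientIsotopy (𝓡∂ 4) (Literature.Topology.FourManifolds.LefschetzBase.Base g)) (_ : ∀ (t : ℝ) (x : Literature.Topology.FourManifolds.LefschetzBase.Base g), Literature.Topology.FourManifolds.LefschetzBase.rho g (R.toFun t x).1 = Literature.Topology.FourManifolds.LefschetzBase.rho g x.1) (_ : ∀ (t : ℝ) (x : Literature.Topology.FourManifolds.LefschetzBase.Base g), ∃ r : ℝ, 0 < r ∧ Literature.Topology.FourManifolds.LefschetzBase.w g (R.toFun t x).1 = (r : ℂ) * Literature.Topology.FourManifolds.LefschetzBase.w g x.1) (_ : ∀ θ, R.toFun 1 ((Literature.Topology.FourManifolds.LefschetzBase.bBase g).incl (Ψ (z θ))) ∈ Literature.Topology.FourManifolds.LefschetzBase.page g c), Literature.Topology.FourManifolds.LefschetzBase.pageTwisting g (R.toFun 1 ∘ fun θ => ((Literature.Topology.FourManifolds.LefschetzBase.bBase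 g).incl (Ψ (z θ)) : Literature.Topology.FourManifolds.LefschetzBase.Base g)) (fun θ => mfderiv (𝓡∂ 4) (𝓡∂ 4) (R.toFun 1) ((Literature.Topology.FourManifolds.LefschetzBase.bBase g).incl (Ψ (z θ))) (mfderiv (𝓡 3) (𝓡∂ 4) (fun y => ((Literature.Topology.FourManifolds.LefschetzBase.bBase g).incl (Ψ y) : Literature.Topology.FourManifolds.LefschetzBase.Base g)) (z θ) (u θ))) = s₀ * Literature.Topology.FourManifolds.LefschetzBase.pageTwisting g K ν := by
  intro g l h hlink X _ _ _ _ _ _ D bX Ψ hpage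
  by_cases hne : Nonempty bX.carrier
  · haveI := hne
    obtain ⟨s₀, hs₀, hsign⟩ := exists_twistSign_global hlink D bX Ψ hpage
    refine ⟨s₀, hs₀, ?_⟩
    intro c hc K ν hK hKp hKb hKν z hz u hu R hRρ hRdir hR1
    exact seam_twistSign_of_sign D bX Ψ hpage hs₀ hsign c hc K ν hK hKp hKb hKν z hz u hu R hRρ hRdir hR1
  · refine ⟨1, Or.inl rfl, ?_⟩
    intro c _ K ν _ _ _ _ z
    exact absurd ⟨z (circlePt 0)⟩ hne

end Summit.SmoothPoincare4.SmoothPoincare4.Theorems.AcyclicBisectionExists.ModpBraidOrbits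

end
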